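import Literature.AlgebraicGeometry.RelativeSpec.GeometricQuotientFreeTorsor
import Literature.AlgebraicGeometry.RelativeSpec.FreeActionOfPoints
import Mathlib.AlgebraicGeometry.Morphisms.FlatMono
import Mathlib.AlgebraicGeometry.Morphisms.IsIso
import Mathlib.AlgebraicGeometry.Morphisms.UniversallyInjective
import Mathlib.AlgebraicGeometry.PullbackCarrier
import HarnessLib

/-!
# Descent along a free finite quotient is effective: an equivariant scheme over a `G`-torsor
# is the base change of its quotient (SGA 1, Exp. V §2 / Exp. VIII 7.8; MFK94 Prop. 7.1, finite-group form)

Let the finite group `G` act on `X` over `Q` with `p : X → Q` an AFFINE geometric quotient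
(`ActionOver.IsGeometricQuotient`, Mumford's (1), (2)) by a FREE action (Chase–Harrison–Rosenberg ring
condition on the affine charts of `Q`, the hypothesis of every free-quotient file of the tree:
★ `IsGeometricQuotient.etale_of_free`, ★ `…isIso_sigmaDesc_graph_of_free`), so that `X → Q` is a
finite étale `G`-torsor (SGA 1 V Déf. 2.7). Let `G` act on a second scheme `Y` over `B` with
`p_Y : Y → B` an affine geometric quotient, and let `f : Y → X` be `G`-EQUIVARIANT, covering
`f̄ : B → Q` (`f ≫ p = p_Y ≫ f̄`; `f̄` is the descended morphism ★ `IsGeometricQuotient.desc`). Then: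

* `free_of_equivariant` — the action on `Y` is free (a `g` fixing a field-valued point of `Y` fixes
  its image in `X`);
* **`isPullback_of_equivariant_of_free`** — the square is CARTESIAN: `Y ≅ B ×_Q X`. Equivalently,
  «`Y → B = Y/G` is a descent of `X`-schemes along the torsor `X → Q`» is EFFECTIVE, with the descended
  object the quotient `Y/G`: this is the finite-group form of SGA 1 VIII 7.8 / [MFK94] Prop. 7.1
  («if `P → X` is a principal `G`-bundle and `Y → P` is a `G`-morphism … then `Y = P ×_X (Y/G)`»),
  in which BOTH quotients are assumed to exist (for quasi-projective schemes over a field they do: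
  ★ `Motives.FiniteQuotient.finiteQuotient`);
* `isIso_of_equivariant_of_free` — **a morphism of `G`-torsors over the same base is an
  isomorphism**: a `G`-equivariant `B`-morphism `u : Y → P` between two free affine geometric
  quotients `Y → B`, `P → B` is an isomorphism (SGA 1 V §2; Greither LNM 1534 Ch. 0);
* `isIso_of_etale_of_forall_injective_of_surjective` — the engine, Mathlib-only: an ÉTALE morphism
  which is SURJECTIVE and INJECTIVE ON `K`-VALUED POINTS for every field `K` is an isomorphism
  (SGA 1 I 5.1 «étale, radiciel et surjectif ⇒ isomorphisme»; ★ `Motives/EtaleBijectiveIso` is the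
  `ℂ`-points special case): injective on field-valued points ⇔ universally injective ⇔ the diagonal is
  surjective (Mathlib `tfae_universallyInjective`), the diagonal of an unramified morphism is an open
  immersion, so it is an isomorphism and `u` is a monomorphism; a flat monomorphism locally of finite
  presentation is an open immersion (Mathlib `IsOpenImmersion.of_flat_of_mono`), and a surjective open
  immersion is an isomorphism.

Proof of the head: the comparison `u = (f, p_Y) : Y → B ×_Q X` is étale (`u ≫ pr_B = p_Y` is étale
by ★ `etale_of_free`, `pr_B` is étale as a base change of `p`; Mathlib `Etale.of_comp`), injective on
`K`-points (two `K`-points of `Y` with the same image in `B` differ by some `g` — ★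
`exists_eq_comp_aut_of_comp_eq_of_free` — and then `g` fixes their common image in `X`, so `g = 1` by ★
`eq_one_of_comp_aut_eq_of_free`) and surjective (a point `z` of `B ×_Q X` and `u y`, `y` over
`pr_B z`, read on a common residue field, have `pr_X`-images in one fibre of `p`, which is a
`G`-orbit; translating `y` by that `g` hits `z`). No action of `G` on the fibre product is constructed
or needed. Everything is proved; no named facts, no definitions.

Mathlib searched (pin): `tfae_universallyInjective`, `FormallyUnramified.isOpenImmersion_diagonal`,
`pullback.isIso_diagonal_iff`, `IsOpenImmersion.of_flat_of_mono`,
`isIso_iff_isOpenImmersion_and_surjective`, `Etale.of_comp`, `Scheme.Pullback.exists_preimage_pullback`,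
`IsPullback.of_iso_pullback` (all used); Mathlib has `MorphismProperty.DescendsAlong` for several
properties along flat covers but no quotients of schemes by finite groups and no torsors over schemes.

## References

* A. Grothendieck, *SGA 1*, Exp. I Thm. 5.1; Exp. V Prop. 2.6, Déf. 2.7; Exp. VIII Cor. 7.8. [SGA1]
* D. Mumford, J. Fogarty, F. Kirwan, *Geometric Invariant Theory*, 3rd ed. (1994), Ch. 7 §1,
  Prop. 7.1 (p. 127). [MumfordFogartyKirwan1994]
* C. Greither, *Cyclic Galois Extensions of Commutative Rings*, LNM 1534 (1992), Ch. 0 §1.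
  [Greither1992CyclicGalois]
* D. Mumford, *Abelian Varieties* (1970), §7 Thm. p. 66; §12 Thm. 1 (p. 112). [MumfordAV1970]
-/

noncomputable section

universe u

open CategoryTheory Limits AlgebraicGeometry TopologicalSpace Opposite

namespace Literature.AlgebraicGeometry.RelativeSpec.ActionOver.IsGeometricQuotient

/-! ### The engine: étale + universally injective + surjective ⇒ isomorphism -/

/-- **SGA 1 I 5.1 «étale, radiciel, surjectif ⇒ isomorphisme»**, in the form used here: an étale
morphism of schemes which is surjective and injective on `K`-valued points for every field `K` is an
isomorphism. Injectivity on field-valued points says the diagonal `Y → Y ×_P Y` is surjective (Mathlib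
`tfae_universallyInjective`); the diagonal of the unramified `u` is an open immersion, hence an
isomorphism, so `u` is a monomorphism; a flat monomorphism locally of finite presentation is an open
immersion (Stacks 06NC), and a surjective open immersion is an isomorphism.
[cite: SGA1, Exp. I Thm. 5.1] -/
theorem isIso_of_etale_of_forall_injective_of_surjective {Y P : Scheme.{u}} (u : Y ⟶ P) [Etale u]
    [Surjective u]
    (hinj : ∀ (K : Type u) [Field K], Function.Injective fun y : Spec (.of K) ⟶ Y => y ≫ u) :
    IsIso u := by
  have hdiag : Surjective (pullback.diagonal u) := ((tfae_universallyInjective u).out 1 3).mp hinj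
  haveI : IsIso (pullback.diagonal u) :=
    (isIso_iff_isOpenImmersion_and_surjective _).mpr ⟨inferInstance, hdiag⟩
  haveI : Mono u := (pullback.isIso_diagonal_iff u).mp inferInstance
  haveI : IsOpenImmersion u := IsOpenImmersion.of_flat_of_mono u
  exact (isIso_iff_isOpenImmersion_and_surjective u).mpr ⟨inferInstance, ‹Surjective u›⟩

variable {X Q : Scheme.{u}} {p : X ⟶ Q} {G : Type u} [Group G] [Fintype G] {ρ : ActionOver p G}
  (hq : ρ.IsGeometricQuotient p) [IsAffineHom p]
  (hfree : ∀ (V : Q.Opens), IsAffineOpen V → ∀ g : G, g ≠ 1 →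
    Ideal.span (Set.range fun b : Γ(X, p ⁻¹ᵁ V) ↦ ρ.act g V b - b) = ⊤)

set_option backward.isDefEq.respectTransparency false

/-! ### Freeness is inherited by equivariant schemes over `X` -/

section Free

include hfree

omit [Fintype G] in
/-- **An equivariant scheme over a free `G`-scheme is free.** If `G` acts freely on `X` (ring
condition on the affine charts of the affine geometric quotient `p : X → Q`) and `f : Y → X` is
`G`-equivariant for an action of `G` on `Y` over `p_Y : Y → B` (`p_Y` affine), then the action on `Y`
is free in the same ring form: a `g` fixing a field-valued point `y` of `Y` fixes `y ≫ f`, so `g = 1`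
(★ `eq_one_of_comp_aut_eq_of_free`), and trivial inertia on field-valued points is the ring condition
(★ `ActionOver.free_of_forall_comp_aut_ne`). [cite: SGA1, Exp. V Prop. 2.6 (i), Déf. 2.7] -/
theorem free_of_equivariant {Y B : Scheme.{u}} {pY : Y ⟶ B} (ρY : ActionOver pY G) [IsAffineHom pY]
    (f : Y ⟶ X) (hf : ∀ g : G, (ρY.aut g).hom ≫ f = f ≫ (ρ.aut g).hom) :
    ∀ (V : B.Opens), IsAffineOpen V → ∀ g : G, g ≠ 1 →
      Ideal.span (Set.range fun b : Γ(Y, pY ⁻¹ᵁ V) ↦ ρY.act g V b - b) = ⊤ := by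
  refine ρY.free_of_forall_comp_aut_ne fun Ω _ _ y g hg hy => hg ?_
  refine eq_one_of_comp_aut_eq_of_free hfree (y ≫ f) ?_
  rw [Category.assoc, ← hf g, ← Category.assoc, hy]

end Free

include hq hfree

/-! ### A morphism of `G`-torsors is an isomorphism -/

/-- **A morphism of `G`-torsors over the same base is an isomorphism** (SGA 1 V §2 / Déf. 2.7;
Greither LNM 1534 Ch. 0): let `p_Y : Y → B` and `p_P : P → B` be affine geometric quotients by `G`
with the action on `P` free, and `u : Y → P` a `G`-equivariant morphism over `B`. Then `u` is an
isomorphism: `Y` is free (`free_of_equivariant`), so `p_Y = u ≫ p_P` is étale (★ `etale_of_free`) and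
`u` is étale (Mathlib `Etale.of_comp`); `u` is injective on `K`-points (two `K`-points of `Y` with the
same image in `P` have the same image in `B`, so differ by some `g` — ★
`exists_eq_comp_aut_of_comp_eq_of_free` — which then fixes their common image in `P`, so `g = 1`);
and `u` is surjective (`G` is transitive on the fibres of `p_P` over field-valued points).
[cite: SGA1, Exp. V Prop. 2.6, Déf. 2.7] [cite: Greither1992CyclicGalois, Ch. 0 §1 (pp. 2–6)] -/
theorem isIso_of_equivariant_of_free {Y : Scheme.{u}} {pY : Y ⟶ Q} {ρY : ActionOver pY G}
    (hqY : ρY.IsGeometricQuotient pY) [IsAffineHom pY] (u : Y ⟶ X) (hu : u ≫ p = pY)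
    (hequiv : ∀ g : G, (ρY.aut g).hom ≫ u = u ≫ (ρ.aut g).hom) : IsIso u := by
  have hfreeY := free_of_equivariant (ρ := ρ) hfree ρY u hequiv
  haveI : Etale p := hq.etale_of_free hfree
  haveI : Etale (u ≫ p) := by rw [hu]; exact hqY.etale_of_free hfreeY
  haveI : Etale u := Etale.of_comp u p
  -- surjective: a point `x` of `X` and `u y`, `y` over `p x`, differ by some `g` on a common field
  haveI : Surjective u := by
    refine ⟨fun x => ?_⟩
    obtain ⟨y, hy⟩ := hqY.surjective (p x)
    obtain ⟨w, hw₁, hw₂⟩ := Scheme.Pullback.exists_preimage_pullback (f := pY) (g := p) y x hy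
    let Ω := (pullback pY p).residueField w
    let y₁ : Spec Ω ⟶ Y := (pullback pY p).fromSpecResidueField w ≫ pullback.fst pY p
    let x₁ : Spec Ω ⟶ X := (pullback pY p).fromSpecResidueField w ≫ pullback.snd pY p
    have h : (y₁ ≫ u) ≫ p = x₁ ≫ p := by
      simp only [y₁, x₁, Category.assoc, hu, pullback.condition]
    obtain ⟨g, hg⟩ := hq.exists_eq_comp_aut_of_comp_eq_of_free hfree (y₁ ≫ u) x₁ h
    refine ⟨(y₁ ≫ (ρY.aut g).hom) (IsLocalRing.closedPoint Ω), ?_⟩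
    rw [← Scheme.Hom.comp_apply, Category.assoc, hequiv g, ← Category.assoc, ← hg]
    show (pullback.snd pY p) ((pullback pY p).fromSpecResidueField w (IsLocalRing.closedPoint Ω)) = x
    rw [Scheme.fromSpecResidueField_apply, hw₂]
  -- injective on `K`-points
  refine isIso_of_etale_of_forall_injective_of_surjective u fun K _ y₁ y₂ (h : y₁ ≫ u = y₂ ≫ u) => ?_
  have hB : y₁ ≫ pY = y₂ ≫ pY := by rw [← hu, ← Category.assoc, h, Category.assoc]
  obtain ⟨g, hg⟩ := hqY.exists_eq_comp_aut_of_comp_eq_of_free hfreeY y₁ y₂ hB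
  have hfix : (y₁ ≫ u) ≫ (ρ.aut g).hom = y₁ ≫ u := by
    rw [Category.assoc, ← hequiv g, ← Category.assoc, ← hg, h]
  have hg1 : g = 1 := eq_one_of_comp_aut_eq_of_free hfree (y₁ ≫ u) hfix
  rw [hg, hg1, map_one]
  exact (Category.comp_id y₁).symm

/-! ### Effective descent: an equivariant scheme over a torsor is the base change of its quotient -/

/-- **Descent along a free finite quotient is effective** (finite-group form of SGA 1 VIII 7.8 /
[MFK94] Prop. 7.1): let `p : X → Q` be an affine geometric quotient by a FREE action of the finite
group `G`, `p_Y : Y → B` an affine geometric quotient by `G`, `f : Y → X` a `G`-EQUIVARIANT morphism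
and `f̄ : B → Q` with `f ≫ p = p_Y ≫ f̄`. Then the square is cartesian: `Y ≅ B ×_Q X`, i.e. the
`X`-scheme `Y` with its descent datum (the `G`-action) descends to the `Q`-scheme `B = Y/G`. Proof: the
comparison `u = (f, p_Y) : Y → B ×_Q X` is étale (`u ≫ pr_B = p_Y` étale, `pr_B` étale), injective on
`K`-points (equal images in `B` ⇒ the two points differ by `g`; equal images in `X` ⇒ `g = 1` by
freeness of `X`) and surjective (fibres of `p` are `G`-orbits), hence an isomorphism
(`isIso_of_etale_of_forall_injective_of_surjective`).
[cite: SGA1, Exp. VIII Cor. 7.8; Exp. V Prop. 2.6, Déf. 2.7]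
[cite: MumfordFogartyKirwan1994, Ch. 7 §1 Prop. 7.1 (p. 127)] -/
theorem isPullback_of_equivariant_of_free {Y B : Scheme.{u}} {pY : Y ⟶ B} {ρY : ActionOver pY G}
    (hqY : ρY.IsGeometricQuotient pY) [IsAffineHom pY] (f : Y ⟶ X) (fbar : B ⟶ Q)
    (hf : ∀ g : G, (ρY.aut g).hom ≫ f = f ≫ (ρ.aut g).hom) (hsq : f ≫ p = pY ≫ fbar) :
    IsPullback f pY p fbar := by
  have hfreeY := free_of_equivariant (ρ := ρ) hfree ρY f hf
  -- the comparison morphism `u = (f, p_Y) : Y → B ×_Q X`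
  obtain ⟨u, hu1, hu2⟩ : ∃ u : Y ⟶ pullback p fbar,
      u ≫ pullback.fst p fbar = f ∧ u ≫ pullback.snd p fbar = pY :=
    ⟨pullback.lift f pY hsq, pullback.lift_fst _ _ _, pullback.lift_snd _ _ _⟩
  haveI : Etale p := hq.etale_of_free hfree
  haveI : Etale (u ≫ pullback.snd p fbar) := by rw [hu2]; exact hqY.etale_of_free hfreeY
  haveI : Etale u := Etale.of_comp u (pullback.snd p fbar)
  -- surjective
  haveI : Surjective u := by
    refine ⟨fun z => ?_⟩
    obtain ⟨y, hy⟩ := hqY.surjective (pullback.snd p fbar z)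
    obtain ⟨w, hw₁, hw₂⟩ :=
      Scheme.Pullback.exists_preimage_pullback (f := pY) (g := pullback.snd p fbar) y z hy
    let W := pullback pY (pullback.snd p fbar)
    let Ω := W.residueField w
    let y₁ : Spec Ω ⟶ Y := W.fromSpecResidueField w ≫ pullback.fst pY (pullback.snd p fbar)
    let z₁ : Spec Ω ⟶ pullback p fbar :=
      W.fromSpecResidueField w ≫ pullback.snd pY (pullback.snd p fbar)
    have hB : y₁ ≫ pY = z₁ ≫ pullback.snd p fbar := by
      simp only [y₁, z₁, Category.assoc, pullback.condition]
    have h : (y₁ ≫ f) ≫ p = (z₁ ≫ pullback.fst p fbar) ≫ p :=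
      calc (y₁ ≫ f) ≫ p = (y₁ ≫ pY) ≫ fbar := by simp only [Category.assoc, hsq]
        _ = (z₁ ≫ pullback.snd p fbar) ≫ fbar := by rw [hB]
        _ = (z₁ ≫ pullback.fst p fbar) ≫ p := by simp only [Category.assoc, pullback.condition]
    obtain ⟨g, hg⟩ := hq.exists_eq_comp_aut_of_comp_eq_of_free hfree (y₁ ≫ f) _ h
    have hz : (y₁ ≫ (ρY.aut g).hom) ≫ u = z₁ := by
      apply pullback.hom_ext
      · rw [Category.assoc, Category.assoc, hu1, hf g, ← Category.assoc, ← hg]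
      · rw [Category.assoc, Category.assoc, hu2, ρY.aut_comp, hB]
    refine ⟨(y₁ ≫ (ρY.aut g).hom) (IsLocalRing.closedPoint Ω), ?_⟩
    rw [← Scheme.Hom.comp_apply, hz]
    show (pullback.snd pY (pullback.snd p fbar)) (W.fromSpecResidueField w (IsLocalRing.closedPoint Ω))
      = z
    rw [Scheme.fromSpecResidueField_apply, hw₂]
  -- injective on `K`-points
  haveI : IsIso u := by
    refine isIso_of_etale_of_forall_injective_of_surjective u
      fun K _ y₁ y₂ (h : y₁ ≫ u = y₂ ≫ u) => ?_
    have hB : y₁ ≫ pY = y₂ ≫ pY := by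
      have e := congrArg (· ≫ pullback.snd p fbar) h
      simpa only [Category.assoc, hu2] using e
    have hX : y₁ ≫ f = y₂ ≫ f := by
      have e := congrArg (· ≫ pullback.fst p fbar) h
      simpa only [Category.assoc, hu1] using e
    obtain ⟨g, hg⟩ := hqY.exists_eq_comp_aut_of_comp_eq_of_free hfreeY y₁ y₂ hB
    have hfix : (y₁ ≫ f) ≫ (ρ.aut g).hom = y₁ ≫ f := by
      rw [Category.assoc, ← hf g, ← Category.assoc, ← hg, hX]
    have hg1 : g = 1 := eq_one_of_comp_aut_eq_of_free hfree (y₁ ≫ f) hfix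
    rw [hg, hg1, map_one]
    exact (Category.comp_id y₁).symm
  exact IsPullback.of_iso_pullback ⟨hsq⟩ (asIso u) hu1 hu2

/-- The same with the descended morphism left implicit: for a `G`-equivariant `f : Y → X` into a free
`G`-torsor `X → Q`, the square over the DESCENDED morphism `f̄ = desc (f ≫ p) : B → Q` of the
`G`-invariant `f ≫ p` (★ `IsGeometricQuotient.desc`, `Q` separated) is cartesian.
[cite: SGA1, Exp. VIII Cor. 7.8] [cite: MumfordFogartyKirwan1994, Ch. 7 §1 Prop. 7.1 (p. 127)] -/
theorem isPullback_desc_of_equivariant_of_free [Q.IsSeparated] {Y B : Scheme.{u}} {pY : Y ⟶ B}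
    {ρY : ActionOver pY G} (hqY : ρY.IsGeometricQuotient pY) [IsAffineHom pY] (f : Y ⟶ X)
    (hf : ∀ g : G, (ρY.aut g).hom ≫ f = f ≫ (ρ.aut g).hom) :
    IsPullback f pY p (hqY.desc (f ≫ p) fun g => by
      rw [← Category.assoc, hf g, Category.assoc, hq.comp_eq]) :=
  hq.isPullback_of_equivariant_of_free hfree hqY f _ hf (hqY.comp_desc _ _).symm

end Literature.AlgebraicGeometry.RelativeSpec.ActionOver.IsGeometricQuotient

end
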